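import Mathlib
import HarnessLib
import HarnessLib.Audit
import Summits.KontsevichZagierPeriods.Statement
import Literature.NumberTheory.Transcendental.KZProductIdeal

/-!
Route: CubicTransport

CLOSED (retired) 2026-08-15T13:48:21Z by operator:999:1257524 — reason: not-a-thesis: assembly does not conclude the sub-problem Statement — note: D-0027 §2.1 audit (human 2026-08-15: routes that do not decide the summit are removed): the assembly concludes `TriplicationAccessible`, not the sub-problem statement; a NEW conforming route may be opened from the same idea (generated `closes : … → _root_.KontsevichZagierPeriods`).. The file is kept as the record of this route; refuted decls are indexed as negative knowledge (`ledger negatives`).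

# Route CubicTransport — Goursat's cubic (G3) at a = 1/6, transported from its trivial anchor x = 0
to the singular fibre x = 1, is Gauss triplication at 1/9 (Neg 0312) up to Beta-cancellation

SECTOR ROUTE realising card two-route-hypergeometric-transport; its terminal node is the shared key
item stmt-0312
(Neg.TriplicationAccessible, whose negation 0311 is route Neg's rank-2 bet), not the summit. X = X1
∧ X2 ("it suffices to show"):
X1 (CubicEndpoint): the x = 1 specialisation of Goursat's cubic transformation (G3)
2F1(a,(2a+1)/6;1/2;x) = (1+x/3)^{-a} 2F1(a/3,(a+1)/3;1/2;x(9-x)^2/(3+x)^3) at a = 1/6, written in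
Euler-period form, holds as a
KZ-equivalence of two explicit 2-dimensional product representations on (0,1)^2:
B(7/18,1/9)·B(2/9,1/9) = (3/4)^{1/6}·B(2/9,5/18)·B(7/18,1/18) (both 143.43224118…); in Gamma form
this is
Γ(1/9)²Γ(4/9) = (3/4)^{1/6}Γ(1/3)Γ(5/18)Γ(1/18), i.e. Gauss triplication at 1/9 modulo Legendre
duplication at 1/18 and 5/18.
X2 (BetaCancellation): Beta-shaped 1-dimensional representations are non-zero-divisors modulo the
moves.
X1 ∧ X2 (+ the provable duplication family) ⟹ stmt-0312. The card's transport mechanism is filed as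
the crux CubicTransportStable
(stable = up to a Beta factor; this is exactly what Wronskian transport with certificates delivers)
with glue Stable → X2 → X1.
Lean: `(∀ (r r' : Literature.NumberTheory.Transcendental.KZ.IntegralRep 2), r.domain = {x | ∀ i, x i
∈ Set.Ioo (0:ℝ) 1} → Set.EqOn r.integrand (fun x => (x 0) ^ (-(11:ℝ)/18) * (1 - x 0) ^ (-(8:ℝ)/9) *
(x 1) ^ (-(7:ℝ)/9) * (1 - x 1) ^ (-(8:ℝ)/9)) r.domain → r'.domain = {x | ∀ i, x i ∈ Set.Ioo (0:ℝ) 1}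
→ Set.EqOn r'.integrand (fun x => ((3:ℝ)/4) ^ ((1:ℝ)/6) * (x 0) ^ (-(7:ℝ)/9) * (1 - x 0) ^
(-(13:ℝ)/18) * (x 1) ^ (-(11:ℝ)/18) * (1 - x 1) ^ (-(17:ℝ)/18)) r'.domain →
Literature.NumberTheory.Transcendental.KZ.Equivalent r r') ∧ (∀ (β :
Literature.NumberTheory.Transcendental.KZ.IntegralRep 1), (∃ (C : ℝ) (p q : ℚ), C ≠ 0 ∧ (-1:ℚ) < p ∧
(-1:ℚ) < q ∧ β.domain = {x | x 0 ∈ Set.Ioo (0:ℝ) 1} ∧ Set.EqOn β.integrand (fun x => C * (x 0) ^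
(p:ℝ) * (1 - x 0) ^ (q:ℝ)) β.domain) → ∀ c : Literature.NumberTheory.Transcendental.KZ.FormalRep,
Literature.NumberTheory.Transcendental.KZ.of β * c ∈
Literature.NumberTheory.Transcendental.KZ.relations → c ∈
Literature.NumberTheory.Transcendental.KZ.relations)`

## Assembly
Γ-monomial bookkeeping inside the product calculus (KZProductIdeal, all PROVED: relations is a
two-sided ideal, products commute modulo
relations, coordinate reindexing is a change-of-variables move): multiply the 0312 product T =
B(1/9,4/9)·B(5/9,7/9) by a Beta spectator
X containing Γ(1/9); regroup with Beta symmetry (u ↦ 1−u), associativity B(x,y)B(x+y,z) ~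
B(y,z)B(y+z,x) (both ~ the Dirichlet simplex
integral by the 2-dim change of variables (u,v) ↦ (u,(1−u)v)) and B(x,1) ~ 1/x (one Newton–Leibniz
move to dimension 0); apply
CubicEndpoint (rewrite Γ(1/9)²Γ(4/9) ⇝ (3/4)^{1/6}Γ(1/3)Γ(5/18)Γ(1/18)), then DuplicationFamily at a
= 5/18 and a = 1/18; the Γ-content
becomes 2·3^{7/6}·Γ(1/2)²·X, i.e. T·X ~ 2·3^{7/6}·[B(1/2,1/2)]·X; cancel X with BetaCancellation;
finally [B(1/2,1/2)] ~ [unit disc, 1]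
(u = (1+v)/2, KZ's own 2∫√(1−v²) = ∫1/√(1−v²) Newton–Leibniz step, then the band |w| ≤ √(1−v²)) and
the scaling (v,w) ↦ (2v,2w) with
constant 3^{7/6}/2 gives stmt-0312's disc of radius 2. Value check: 3Γ(1/9)Γ(4/9)Γ(7/9)/Γ(1/3) =
2π·3^{7/6} = 22.6371282948….

Rationale: WHY THIS LINE. Transformation theory is the ALGEBRAIC part of Gamma-lore (φ rational, λ algebraic),
and Goursat's cubic list (Goursat1881; Vidunas2009 §4,
covering (1/2,1/3,p) ←3– (1/2,p,2p)) contains one member, (G3), whose covering φ(x) = x(9−x)²/(3+x)³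
maps [0,1] monotonically onto [0,1]
(φ' ∝ (9−x)(1−x)/(3+x)⁴), with regular prefactor, so that at a = 1/6 BOTH sides are Gauss-summable
at the common endpoint x = φ(x) = 1
(margins c−a−b = 1/9 and 1/18) while the anchor x = 0 is the SAME product of two Beta integrals up
to a coordinate swap; the endpoint
identity of Gauss sums is, after two duplications, literally the triplication instance behind
stmt-0312 (checked here: series identity to
4e-15 on (0,1), period form by quadrature to 1e-8 at x = 0.3, 0.8, 1). This turns the tree's most
informative open item into
"transport one algebraic identity along one real algebraic arc", importing classical hypergeometric
transformation theory
(AndrewsAskeyRoy1999 Ch. 3, GesselStanton1982) and creative-telescoping certificates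
(BostanLairezSalvy2013, Lairez2015) into the move
calculus, with twisted de Rham theory (AomotoKita2011 §3.5–3.6: Wronskians are Gamma-products;
twisted period relations) explaining the
seam found while planning: certificates transport only the Wronskian (rank-1, algebraic gauge
x^{1/2}(1−x)^{8/9}) combination, so the
LINEAR identity arrives multiplied by a Beta spectator (the period of the dual class) — removing it
is a cancellation statement of the
same kind as KZ.PiCancellation (stmt-0540, HuberWustholz2022 App. A.4). No prior route uses
transformations: Neg/ExpConservative attack
0312 through Γ (exponential periods), the isogeny and correspondence cards through CM cycles on
Fermat surfaces.

RANKED CRUXES. #0 TriplicationAccessible (target) — = stmt-KontsevichZagierPeriods-0312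
(Neg.TriplicationAccessible) verbatim, re-asked so this route is attached to the shared item: the
Gauss-triplication pair — [(0,1)², x^{-8/9}(1−x)^{-5/9}y^{-4/9}(1−y)^{-2/9}] (value
B(1/9,4/9)B(5/9,7/9)) and [disc of radius 2, constant 3^{7/6}/2] (value 2π·3^{7/6} = 22.6371282948…)
— is KZ-equivalent. (why it might fail: It is the negation of Neg's bet 0311: the identity is only
known through Γ (an exponential period) or through an absolute-Hodge class on the degree-9 Fermat
surface; no rules-proof is recorded.) [Deligne1982HodgeCycles, Waldschmidt2006,
KontsevichZagier2001]
#2 CubicEndpoint (crux) — the x = 1 specialisation of (G3) at a = 1/6 in Euler-period form, as a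
KZ-equivalence of two 2-dim representations on (0,1)²: integrand
s^{-11/18}(1−s)^{-8/9}·t^{-7/9}(1−t)^{-8/9} (value B(7/18,1/9)·B(2/9,1/9)) versus
(3/4)^{1/6}·s^{-7/9}(1−s)^{-13/18}·t^{-11/18}(1−t)^{-17/18} (value
(3/4)^{1/6}·B(2/9,5/18)·B(7/18,1/18)); both 143.43224118…; in Γ-form Γ(1/9)²Γ(4/9) =
(3/4)^{1/6}Γ(1/3)Γ(5/18)Γ(1/18) = triplication at 1/9 modulo duplication at 1/18 and 5/18 (card item
H3, made explicit). [difficulty: open-problem] (why it might fail: Equivalent to 0312 modulo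
accessible duplication, so it inherits Neg's bet 0311; transport reaches it only up to a Beta
spectator (needs BetaCancellation) and must cross the singular fibre x = 1, where Abel's limit is
not a move.) [Vidunas2009, Goursat1881, AndrewsAskeyRoy1999, Deligne1982HodgeCycles]
#3 BetaCancellation (crux) — every 1-dimensional representation of Beta shape (domain (0,1),
integrand C·u^p(1−u)^q with C ≠ 0 real and p, q > −1 rational) is a non-zero-divisor modulo the
moves: [β]·c ∈ relations ⇒ c ∈ relations. It follows from KZKernelConjecture (eval is
multiplicative, KZProductIdeal eval_mul', and B(p+1,q+1) ≠ 0), generalises the flavour of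
KZ.PiCancellation (stmt-0540), and is what upgrades stable transport to the clean identities.
[difficulty: open-problem] (why it might fail: Kernel-conjecture strength: a proof needs structure
of FormalRep/relations nobody has (same effective-vs-localised seam as PiCancellation 0540,
HuberWustholz2022 App. A.4); a refutation (a Beta zero-divisor with non-zero value) would refute the
summit itself.) [HuberWustholz2022, KontsevichZagier2001, AomotoKita2011, Ayoub2015]
#4 CubicTransportStable (crux) — for every real algebraic x ∈ [0,1] the two sides of (G3) at a = 1/6
in period form — A(x) on (0,1)² with integrand
u^{-11/18}(1−u)^{-8/9}·t^{-7/9}(1−t)^{-13/18}(1−xt)^{-1/6} (=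
B(7/18,1/9)·B(2/9,5/18)·2F1(1/6,2/9;1/2;x)) and B(x) with integrand
(1+x/3)^{-1/6}·u^{-7/9}(1−u)^{-13/18}·s^{-11/18}(1−s)^{-8/9}(1−φ(x)s)^{-1/18}, φ(x) = x(9−x)²/(3+x)³
— are STABLY KZ-equivalent: some finite product of Beta-shape representations multiplies [A(x)] −
[B(x)] into relations. Mechanism (card H1/H-b made honest): A(0), B(0) are the same product rep up
to the coordinate swap (trivial anchor); creative-telescoping certificates L_x f = ∂_t(C·f) for both
kernels transport the Wronskian combinations p·W (p = x^{1/2}(1−x)^{8/9}) by Newton–Leibniz in x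
plus Newton–Leibniz in t killing total derivatives; a partner solution x^{1/2}·(Euler family of
2F1(2/3,13/18;3/2;x)) for 0 < x < 1 and the exponent-1/9 probe solution at x = 1 (p·∂_x v has a
finite pointwise limit, so the x-band reaches the singular fibre) give β₃·(A(x) − B(x)) ∈ relations
and β₃·β_v·(A(1) − B(1)) ∈ relations with spectators β₃ = B(5/6,2/3), β_v = B(5/18,5/6).
[difficulty: XL] (why it might fail: Certificate boundary terms C·f must vanish on CLOSED fibres t =
0,1 for exponents (2/9,5/18),(7/18,1/9), and second x-derivative kernels must stay integrable on
bands up to x = 1 where the margin is exactly c−a−b = 1/9 resp. 1/18; one non-integrable corner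
breaks the chain.) [BostanLairezSalvy2013, Lairez2015, AomotoKita2011, Vidunas2009,
KontsevichZagier2001]
#9 DuplicationFamily (support) — Legendre duplication in Beta form for every rational a > 0: [(0,1),
(u(1−u))^{a−1}] ~ [(0,1), 2^{1−2a}·u^{-1/2}(1−u)^{a−1}] (three moves: split at u = 1/2, u ↦ 1−u, t =
4u(1−u)); stmt-0118 is the instance a = 1/3; the Assembly uses a = 1/18 and a = 5/18. [difficulty:
provable-now] [AndrewsAskeyRoy1999, KontsevichZagier2001]
#9 TransportGlue (support) — glue of the foreseen split of CubicEndpoint: CubicTransportStable →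
BetaCancellation → CubicEndpoint (instantiate x = 1: φ(1) = 1, (1+1/3)^{-1/6} = (3/4)^{1/6},
(1−t)^{-13/18}(1−t)^{-1/6} = (1−t)^{-8/9} pointwise on (0,1), so the Set.EqOn hypotheses transfer;
then cancel the Beta spectators by induction on the list). [deps: CubicTransportStable,
BetaCancellation, CubicEndpoint] [difficulty: provable-now] [KontsevichZagier2001]

TWO-LAYER PLAN. Foreseen glued splits (none filed now): CubicEndpoint ⇐ CubicTransportStable →
BetaCancellation → CubicEndpoint (glue = TransportGlue,
already typed); CubicTransportStable ⇐ InteriorWronskianTransport (all algebraic x < 1, spectator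
β₃) → EndpointProbe (x = 1, spectator
β_v) → CubicTransportStable; BetaCancellation ⇐ KZ.PiCancellation (stmt-0540, shared with
AyoubSpecialisation) → BetaComplement
(β·β′ ~ q·[π]^k from twisted period relations, AomotoKita2011 Example 3.4) → BetaCancellation. k ≤ 3
each, depth 1.

KILL CRITERIA. Refutation of TriplicationAccessible or CubicEndpoint (an additive invariant of
FormalRep killing the four move sets and separating the
pair, shape Neg 0313) closes the route `refuted:<Decl>` and is Neg's win. Refutation of
BetaCancellation or of CubicTransportStable
(value-consistent statements) contradicts KZKernelConjecture, hence the summit: close refuted and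
report to the operator. If a prover's
census shows the certificate chain has a non-integrable corner at x = 1 only: restate
CubicTransportStable on [0,1) (Ico) and file the
endpoint as its own crux — a pivot, not a kill. If stmt-0312 is proved first by the
isogeny/correspondence cards, the route keeps only
its H1 value (stable transport of a transformation family): downgrade to dormant or close
`superseded`.

NOT DECOMPOSED YET. The certificates themselves (explicit telescopers C(t,x) for the kernel of
2F1(1/6,2/9;1/2;x) and for the φ-pulled-back kernel; a CAS
job) and the integrability/boundary lemmas — layer-2 children of CubicTransportStable; the
BetaComplement identities (twisted period
relations B(α,β)B(−α,−β)(1/α+1/β) = 2πi·(…), AomotoKita2011 §3.6 Example 3.4) that would reduce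
BetaCancellation to PiCancellation
(stmt-0540); whether a spectator-free Beta-product chain from CubicEndpoint to 0312 exists (monoid
versus Grothendieck group of Beta
products — if yes, BetaCancellation leaves the Assembly); the general-parameter (G3) family
(triplication at (1−2a)/6 for all rational
a < 1/4) and the quadratic family AndrewsAskeyRoy1999 (3.1.11) (duplication at all rationals by
transport) — not filed; the card's
literal two-route variant (AndrewsAskeyRoy1999 (3.1.16)–(3.1.17) against Vidunas2009's second cubic
at x = 1/9, triplication at (a+1)/6,
a = −1/3 for ninths) — three transformations and the same two seams, recorded in NOTES only;
rpow-semialgebraicity and integrability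
constructors for Beta/Euler representations (prover lemmas via --supports).

CHEAPEST FALSIFIER. Done while planning: (i) (G3) at a = 0.1, 1/6, 0.2 against the series on x ∈
{0.1,…,0.7}: agreement to 4e-15 (no branch problem of
the AndrewsAskeyRoy1999 (3.1.3)/(3.1.6) kind: φ is monotone [0,1] → [0,1]); (ii) period form by
quadrature at x = 0.3, 0.8, 1.0:
relative agreement 1e-8, endpoint 143.43224118 on both sides; (iii) Γ-bookkeeping: endpoint +
duplication(1/18, 5/18) ⟺
Γ(1/9)Γ(4/9)Γ(7/9) = 2π3^{1/6}Γ(1/3) ⟺ 0312 (22.63712829483 both sides). Still to run (refuter,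
10-line CAS job): the telescoper
certificate for t^{-7/9}(1−t)^{-13/18}(1−xt)^{-1/6} under L = x(1−x)∂² + (1/2 − (25/18)x)∂ − 1/27
and for the pulled-back kernel;
if a certificate has a pole inside (0,1) × [0,1] or its boundary term diverges at x = 1,
CubicTransportStable must be restated
(domain split / Ico), and if no rational certificate exists for the pulled-back side the transport
mechanism is dead (CubicEndpoint
survives as a bare bet).

NUMBERS. (G3): 2F1(a,(2a+1)/6;1/2;x) = (1+x/3)^{-a}·2F1(a/3,(a+1)/3;1/2;x(9−x)²/(3+x)³) (Vidunas2009
§4, third two-term cubic formula;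
Goursat1881); a = 1/6: (a,b,c) = (1/6,2/9,1/2), (a′,b′,c′) = (1/18,7/18,1/2); c−a−b = 1/9, c′−a′−b′
= 1/18; φ′ ∝ 27(9−x)(1−x)/(3+x)⁴,
φ(1) = 1 double; λ(1) = (3/4)^{1/6}; Gauss sums at x = 1: 1.7382432619 both sides; endpoint product
value 143.43224118085;
0312 value 22.63712829483 = 2π·3^{7/6}; gauge p(x) = x^{1/2}(1−x)^{8/9}; spectators: partner anchor
B(1−a,1+a−c) = B(5/6,2/3),
probe kernel B(c−b,1−a) = B(5/18,5/6). Items at open: 7 (1 target, 3 cruxes, 2 support, 1 assembly).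

DEFINITION REQUESTS. None. All statements are over
Literature.NumberTheory.Transcendental.KZ.{IntegralRep, Equivalent, FormalRep, of, relations} and
the
ring structure of KZProduct/KZProductIdeal (import
Literature.NumberTheory.Transcendental.KZProductIdeal); Sketch.lean rc 0 on the farm.

Novelty: Searches (2026-08-15): `lit search --hybrid "cubic transformation hypergeometric … gamma"` (15 docs;
AAR, Fuselier–Long–Ramakrishna–
Swisher–Tu 2022 = Gessel–Stanton analogues), `lit search --hybrid "Goursat cubic transformation
hypergeometric"` (12), `lit read
arxiv:math/0408269 --grep cubic` (Vidunas2009 §4 list, read pp. 10–11), `lit read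
book:andrews1999-special-functions` pp. 101–106, 140
(Thm 3.1.1, Cor 3.1.2, Thm 3.1.3, Remark, (3.1.15)–(3.1.18), Ex. 38), `lit read
book:aomoto2011-theory-hypergeometric-functions`
(Thm 3.5, §3.5.9, Example 3.4/3.5), `lit search --source zbmath "multiplication formula gamma
function"` (15: Stolarsky 1991,
Vidunas2005, none via transformations), `lit search --source crossref "cubic transformation
hypergeometric gamma"` (12, none),
`lit galaxy search "triplication formula" --star all` (17: Berndt–Bhargava–Garvan cubic theta,
unrelated), `lit galaxy search "cubic
transformation of the hypergeometric" --star all` (5: Erdélyi HTF I, Whittaker–Watson, NIST), `lit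
frontier KontsevichZagierPeriods
--since 2020`, `lit bridges KontsevichZagierPeriods --cross any` (nothing on transformations),
`ledger negatives` (empty); OpenAlex/S2 rate-limited.
Nearest prior art found: AndrewsAskeyRoy1999 Cor. 3.1.2 and the Remark after (3.1.8) (quadratic
transformation + Gauss sum, anchor x = 0
⟹ Legendre DUPLICATION) and (3.1.16)–(3.1.17) (two transformation routes ⟹ evaluation at 1/9);
Vidunas2009 §4 / Goursat1881 (the cubic
formulas and coverings, no Γ-identi  [refs: math/0408269, arxiv:math/0408269, book:andrews1999-special-functions, book:aomoto2011-theory-hypergeometric-functions, Vidunas2009, Vidunas2005, AndrewsAskeyRoy1999, GesselStanton1982, AomotoKita2011, HuberWustholz2022]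

Barriers (technique_class: hypergeometric-transformation flat-transport cancellation): - technique_class: hypergeometric-transformation flat-transport cancellation
- Literature.Barriers.KontsevichZagierPeriods.noSemialgebraicPrimitive_inv_sub_two: evaded — no
primitive of an integrand in its own variable is ever taken; the x-direction primitive is the
algebraic integrand family itself and the t-direction primitives are certificate·kernel (rational ×
algebraic); the transcendental primitive ∫dx/p (incomplete Beta, non-algebraic by Chebyshev) is
exactly what the Wronskian formulation avoids — at the price of the Beta spectator (crux
BetaCancellation).
- Literature.Barriers.KontsevichZagierPeriods.kzConjecture_implies_oddZetaAlgIndep: not engaged —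
sector statements about explicit hypergeometric periods of a CM/Fermat type; no
algebraic-independence consequence follows from 0312.
- Literature.Barriers.KontsevichZagierPeriods.kzConjecture_implies_twoPiI_log_algIndep: not engaged
(same reason; the only transcendental constant produced is π as the unit disc).
- Literature.Barriers.KontsevichZagierPeriods.kzConjecture_implies_ellipticPeriods_algIndep: not
engaged (no elliptic periods; Beta values at ninths are periods of the Fermat curve F₉ with CM,
where Chudnovsky-type independence is not claimed or used).
- Literature.Barriers.KontsevichZagierPeriods.cressonViuSos_prop_3_2: not engaged — every step is a
chain of moves with dissection (domain additivity at t = 1/2 etc.), never one global semialgebraic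
map.
- Literature.Barriers.KontsevichZagierPeriods.not_complete_o

History (route lifecycle, newest last):
- 2026-08-15T13:48:21Z · CLOSED retired — not-a-thesis: assembly does not conclude the sub-problem Statement (operator:999:1257524)

sub-problem: KontsevichZagierPeriods · status: closed(retired) · opened planner-plancard-KontsevichZagierPeriods-Kont-835ffb7a-0 2026-08-15T11:23:14Z · rev 0 · ledger route-KontsevichZagierPeriods-CubicTransport
GENERATED by the gate from the ledger (D-0016/17). Provers cite these decls: `theorem foo : Summit.KontsevichZagierPeriods.KontsevichZagierPeriods.Theses.CubicTransport.<Decl> := …` in Summits/KontsevichZagierPeriods/KontsevichZagierPeriods/Theorems/<Name>.lean.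
-/

namespace Summit.KontsevichZagierPeriods.KontsevichZagierPeriods.Theses.CubicTransport

open scoped BigOperators Topology Manifold Classical MeasureTheory ProbabilityTheory Matrix InnerProductSpace ComplexConjugate ContinuousMap
open Filter Set Function TopologicalSpace MeasureTheory

attribute [summit_statement] _root_.KontsevichZagierPeriods

open Literature Periods

/-- item stmt-KontsevichZagierPeriods-0312 · target · rank 0 · open · by planner
why it might fail: It is the negation of Neg's bet 0311: the identity is only known through Γ (an exponential period) or through an absolute-Hodge class on the degree-9 Fermat surface; no rules-proof is recorded.
sources: Deligne1982HodgeCycles, Waldschmidt2006, KontsevichZagier2001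
Positive form of #2. A proof must avoid Γ: candidate strategy = realise the degree-9 Fermat-curve
correspondence behind the identity as semialgebraic changes of variables between (blow-ups of)
(0,1)² pieces plus Newton–Leibniz with algebraic primitives (Rohrlich/Deligne distribution relations
are induced by the maps x ↦ x³ on Fermat curves — algebraic, finite ⇒ CoV on injectivity cells). If
found, pressure point (b) of route Neg dies at its first instance. [elaborates: yes:
_survey/SketchB.lean; sources: Deligne1982HodgeCycles, KontsevichZagier2001] -/
@[route_item "route-KontsevichZagierPeriods-CubicTransport"]
def TriplicationAccessible : Prop :=
  ∀ (r r' : Literature.NumberTheory.Transcendental.KZ.IntegralRep 2), r.domain = {x | ∀ i, x i ∈ Set.Ioo (0:ℝ) 1} → Set.EqOn r.integrand (fun x => (x 0) ^ (-(8:ℝ)/9) * (1 - x 0) ^ (-(5:ℝ)/9) * (x 1) ^ (-(4:ℝ)/9) * (1 - x 1) ^ (-(2:ℝ)/9)) r.domain → r'.domain = {x | x 0 ^ 2 + x 1 ^ 2 < 4} → Set.EqOn r'.integrand (fun _ => (3:ℝ) ^ ((7:ℝ)/6) / 2) r'.domain → Literature.NumberTheory.Transcendental.KZ.Equivalent r 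r'

/-- item stmt-KontsevichZagierPeriods-3724 · crux · rank 2 · closed · moot by None · by planner
why it might fail: Equivalent to 0312 modulo accessible duplication, so it inherits Neg's bet 0311; transport reaches it only up to a Beta spectator (needs BetaCancellation) and must cross the singular fibre x = 1, where Abel's limit is not a move.
sources: Vidunas2009, Goursat1881, AndrewsAskeyRoy1999, Deligne1982HodgeCycles
[crux] the x = 1 specialisation of (G3) at a = 1/6 in Euler-period form, as a KZ-equivalence of two
2-dim representations on (0,1)²: integrand s^{-11/18}(1−s)^{-8/9}·t^{-7/9}(1−t)^{-8/9} (value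
B(7/18,1/9)·B(2/9,1/9)) versus (3/4)^{1/6}·s^{-7/9}(1−s)^{-13/18}·t^{-11/18}(1−t)^{-17/18} (value
(3/4)^{1/6}·B(2/9,5/18)·B(7/18,1/18)); both 143.43224118…; in Γ-form Γ(1/9)²Γ(4/9) =
(3/4)^{1/6}Γ(1/3)Γ(5/18)Γ(1/18) = triplication at 1/9 modulo duplication at 1/18 and 5/18 (card item
H3, made explicit). [difficulty: open-problem] -/
@[route_item "route-KontsevichZagierPeriods-CubicTransport"]
def CubicEndpoint : Prop :=
  ∀ (r r' : Literature.NumberTheory.Transcendental.KZ.IntegralRep 2), r.domain = {x | ∀ i, x i ∈ Set.Ioo (0:ℝ) 1} → Set.EqOn r.integrand (fun x => (x 0) ^ (-(11:ℝ)/18) * (1 - x 0) ^ (-(8:ℝ)/9) * (x 1) ^ (-(7:ℝ)/9) * (1 - x 1) ^ (-(8:ℝ)/9)) r.domain → r'.domain = {x | ∀ i, x i ∈ Set.Ioo (0:ℝ) 1} → Set.EqOn r'.integrand (fun x => ((3:ℝ)/4) ^ ((1:ℝ)/6) * (x 0) ^ (-(7:ℝ)/9) * (1 - x 0) ^ (-(13:ℝ)/18)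 * (x 1) ^ (-(11:ℝ)/18) * (1 - x 1) ^ (-(17:ℝ)/18)) r'.domain → Literature.NumberTheory.Transcendental.KZ.Equivalent r r'

/-- item stmt-KontsevichZagierPeriods-3725 · crux · rank 3 · closed · moot by None · by planner
why it might fail: Kernel-conjecture strength: a proof needs structure of FormalRep/relations nobody has (same effective-vs-localised seam as PiCancellation 0540, HuberWustholz2022 App. A.4); a refutation (a Beta zero-divisor with non-zero value) would refute the summit itself.
sources: HuberWustholz2022, KontsevichZagier2001, AomotoKita2011, Ayoub2015
[crux] every 1-dimensional representation of Beta shape (domain (0,1), integrand C·u^p(1−u)^q with C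
≠ 0 real and p, q > −1 rational) is a non-zero-divisor modulo the moves: [β]·c ∈ relations ⇒ c ∈
relations. It follows from KZKernelConjecture (eval is multiplicative, KZProductIdeal eval_mul', and
B(p+1,q+1) ≠ 0), generalises the flavour of KZ.PiCancellation (stmt-0540), and is what upgrades
stable transport to the clean identities. [difficulty: open-problem] -/
@[route_item "route-KontsevichZagierPeriods-CubicTransport"]
def BetaCancellation : Prop :=
  ∀ (β : Literature.NumberTheory.Transcendental.KZ.IntegralRep 1), (∃ (C : ℝ) (p q : ℚ), C ≠ 0 ∧ (-1:ℚ) < p ∧ (-1:ℚ) < q ∧ β.domain = {x | x 0 ∈ Set.Ioo (0:ℝ) 1} ∧ Set.EqOn β.integrand (fun x => C * (x 0) ^ (p:ℝ) * (1 - x 0) ^ (q:ℝ)) β.domain) → ∀ c : Literature.NumberTheory.Transcendental.KZ.FormalRep, Literature.NumberTheory.Transcendental.KZ.of β * c ∈ Literature.NumberTheory.Transcendental.KZ.relations → c ∈ Literature.NumberTheory.Transcendental.KZ.relations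

/-- item stmt-KontsevichZagierPeriods-3726 · crux · rank 4 · closed · moot by None · by planner
why it might fail: Certificate boundary terms C·f must vanish on CLOSED fibres t = 0,1 for exponents (2/9,5/18),(7/18,1/9), and second x-derivative kernels must stay integrable on bands up to x = 1 where the margin is exactly c−a−b = 1/9 resp. 1/18; one non-integrable corner breaks the chain.
sources: BostanLairezSalvy2013, Lairez2015, AomotoKita2011, Vidunas2009, KontsevichZagier2001
[crux] for every real algebraic x ∈ [0,1] the two sides of (G3) at a = 1/6 in period form — A(x) on
(0,1)² with integrand u^{-11/18}(1−u)^{-8/9}·t^{-7/9}(1−t)^{-13/18}(1−xt)^{-1/6} (=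
B(7/18,1/9)·B(2/9,5/18)·2F1(1/6,2/9;1/2;x)) and B(x) with integrand
(1+x/3)^{-1/6}·u^{-7/9}(1−u)^{-13/18}·s^{-11/18}(1−s)^{-8/9}(1−φ(x)s)^{-1/18}, φ(x) = x(9−x)²/(3+x)³
— are STABLY KZ-equivalent: some finite product of Beta-shape representations multiplies [A(x)] −
[B(x)] into relations. Mechanism (card H1/H-b made honest): A(0), B(0) are the same product rep up
to the coordinate swap (trivial anchor); creative-telescoping certificates L_x f = ∂_t(C·f) for both
kernels transport the Wronskian combinations p·W (p = x^{1/2}(1−x)^{8/9}) by Newton–Leibniz in x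
plus Newton–Leibniz in t killing total derivatives; a partner solution x^{1/2}·(Euler family of
2F1(2/3,13/18;3/2;x)) for 0 < x < 1 and the exponent-1/9 probe solution at x = 1 (p·∂_x v has a
finite pointwise limit, so the x-band reaches the singular fibre) give β₃·(A(x) − B(x)) ∈ relations
and β₃·β_v·(A(1) − B(1)) ∈ relations with spectators β₃ = B(5/6,2/3), β_v = B(5/18,5/6).
[difficulty: XL] -/
@[route_item "route-KontsevichZagierPeriods-CubicTransport"]
def CubicTransportStable : Prop :=
  ∀ x : ℝ, IsAlgebraic ℚ x → x ∈ Set.Icc (0:ℝ) 1 → ∀ (r r' : Literature.NumberTheory.Transcendental.KZ.IntegralRep 2), r.domain = {y | ∀ i, y i ∈ Set.Ioo (0:ℝ) 1} → Set.EqOn r.integrand (fun y => (y 0) ^ (-(11:ℝ)/18) * (1 - y 0) ^ (-(8:ℝ)/9) * (y 1) ^ (-(7:ℝ)/9) * (1 - y 1) ^ (-(13:ℝ)/18) * (1 - x * y 1) ^ (-(1:ℝ)/6)) r.domain → r'.domain = {y | ∀ i, y i ∈ Set.Ioo (0:ℝ) 1} → Set.EqOn r'.integrand (fun y => (1 + x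 / 3) ^ (-(1:ℝ)/6) * (y 0) ^ (-(7:ℝ)/9) * (1 - y 0) ^ (-(13:ℝ)/18) * (y 1) ^ (-(11:ℝ)/18) * (1 - y 1) ^ (-(8:ℝ)/9) * (1 - (x * (9 - x) ^ 2 / (3 + x) ^ 3) * y 1) ^ (-(1:ℝ)/18)) r'.domain → ∃ l : List (Literature.NumberTheory.Transcendental.KZ.IntegralRep 1), (∀ β ∈ l, ∃ (C : ℝ) (p q : ℚ), C ≠ 0 ∧ (-1:ℚ) < p ∧ (-1:ℚ) < q ∧ β.domain = {y | y 0 ∈ Set.Ioo (0:ℝ) 1} ∧ Set.EqOn β.integrand (fun y => C * (y 0) ^ (p:ℝ) * (1 - y 0) ^ (q:ℝ)) β.domain) ∧ l.foldr (fun β c => Literature.NumberTheory.Transcendental.KZ.of β * c) (Literature.NumberTheory.Transcendental.KZ.of r - Literature.NumberTheory.Transcendental.KZ.of r') ∈ Literature.NumberTheory.Transcendental.KZ.relations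

/-- item stmt-KontsevichZagierPeriods-3727 · support · rank 9 · closed · proved by Summit.KontsevichZagierPeriods.MellinCoarea.duplicationFamily_proof @ e561ebe3bd4b (prover) · by planner
sources: AndrewsAskeyRoy1999, KontsevichZagier2001
[support] Legendre duplication in Beta form for every rational a > 0: [(0,1), (u(1−u))^{a−1}] ~
[(0,1), 2^{1−2a}·u^{-1/2}(1−u)^{a−1}] (three moves: split at u = 1/2, u ↦ 1−u, t = 4u(1−u));
stmt-0118 is the instance a = 1/3; the Assembly uses a = 1/18 and a = 5/18. [difficulty:
provable-now] -/
@[route_item "route-KontsevichZagierPeriods-CubicTransport"]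
def DuplicationFamily : Prop :=
  ∀ a : ℚ, 0 < a → ∀ (r r' : Literature.NumberTheory.Transcendental.KZ.IntegralRep 1), r.domain = {x | x 0 ∈ Set.Ioo (0:ℝ) 1} → Set.EqOn r.integrand (fun x => (x 0 * (1 - x 0)) ^ ((a:ℝ) - 1)) r.domain → r'.domain = {x | x 0 ∈ Set.Ioo (0:ℝ) 1} → Set.EqOn r'.integrand (fun x => (2:ℝ) ^ (1 - 2 * (a:ℝ)) * (x 0) ^ (-(1:ℝ)/2) * (1 - x 0) ^ ((a:ℝ) - 1)) r'.domain → Literature.NumberTheory.Transcendental.KZ.Equivalent r r'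

/-- item stmt-KontsevichZagierPeriods-3728 · support · rank 9 · closed · moot by None · by planner
sources: KontsevichZagier2001
[support] glue of the foreseen split of CubicEndpoint: CubicTransportStable → BetaCancellation →
CubicEndpoint (instantiate x = 1: φ(1) = 1, (1+1/3)^{-1/6} = (3/4)^{1/6}, (1−t)^{-13/18}(1−t)^{-1/6}
= (1−t)^{-8/9} pointwise on (0,1), so the Set.EqOn hypotheses transfer; then cancel the Beta
spectators by induction on the list). [deps: CubicTransportStable, BetaCancellation, CubicEndpoint]
[difficulty: provable-now] -/
@[route_item "route-KontsevichZagierPeriods-CubicTransport"]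
def TransportGlue : Prop :=
  CubicTransportStable → BetaCancellation → CubicEndpoint

/-- item stmt-KontsevichZagierPeriods-3729 · assembly · rank 1 · closed · moot by None · by planner
sources: KontsevichZagier2001, AndrewsAskeyRoy1999
[assembly] CubicEndpoint → BetaCancellation → DuplicationFamily → TriplicationAccessible (terminal
node = shared item stmt-0312, not the summit: sector route). -/
@[route_item "route-KontsevichZagierPeriods-CubicTransport"]
def Assembly : Prop :=
  CubicEndpoint → BetaCancellation → DuplicationFamily → TriplicationAccessible

end Summit.KontsevichZagierPeriods.KontsevichZagierPeriods.Theses.CubicTransport
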